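import Summits.QuantumFields.BalabanUV.Beta.GAN24.LegTowerSlavedRows
import Summits.QuantumFields.BalabanUV.Beta.GAN24.LegLetterParity
import Summits.QuantumFields.BalabanUV.Beta.GAN24.Lin4ParityCovariance

/-!
# `BalabanUV.Beta.GAN24.LegLetterRowsOfLegChain` — binder row G-an2-4 ∕ (CONV-C), W-slot, the (α-0) parity re-cut, row L11 (Q-L): **THE LEG LETTER ROWS OF THE
# PARITY `ε`-MEMBER FROM THE RULED CHAIN DISPLAY** — FILE 3c `T2ShapeEvenMemberOfWardLetters` ∕ leaf-01's `T2DriftEvenMemberOfWardLetters` rows `hL₁ hL₂` (`∀ l`, ONE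
# constant) ⟸ (H1♮)_δ ∧ (H2)_δ ∧ (H0)_δ ∧ (H3), all in `LocStencil₂` currency at the `ε`-member's own objects (G-an2-4 formalisation swarm, leaf prover
# `b2b-balaban-gan24-formalise-leaf-03`, gen 67; FILE 3 of the journal INTENT [LEAF03-G67-ONLINE] «(Q-L) LETTER ROWS ⟸ THE RULED DISPLAY»; composes MY FILE 1
# `LegTowerSlavedRows` (the END with the slaved term), MY FILE 2 `LegLetterParity` (one leg tower per parity member) and leaf-01 g71's `Lin4ParityCovariance` ∕
# `AffineUnrollProjected` (the `ε`-member's DRESSED affine law))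

NOT IN PRINT; OUR BOOKKEEPING ([folklore] composition BY NAME; 0 `def`, 0 cited facts, 0 `def … : Prop`, 0 sorry).  HONEST FRAMING (cell contract, verbatim):
«discharging `BetaPertH` makes Bałaban's UV stability UNCONDITIONAL — a real constructive-QFT result; it is NOT the continuum limit and NOT the Clay problem.»
HONEST DEPENDENCY (verbatim): «continuum YM on T⁴ ⇐ BetaPertH ∧ nine spine estimates (0/9 proved); BetaPertH ⇐ (D1) ∧ (D4) ∧ CAP+tail; G-an2-4 gates asym, D1
and NE2/3/4.»

OBJECTS (generic `d`, `1 ≤ Lc`, in-block root `r`, pins `(cE, cVH, cΛ, cE₂, cB)`, initial table `Tc`, off-diagonal `LocStencil₂` border `vh₂S`; level units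
`sfStep ∕ smStep`): `T̃_l := unitS₂_l (T2RecAt d Lc (toSite r) … l)` an2's normalised comb member, `P X s := sgnK (trK (X s))` the slotwise parity, the `ε`-MEMBER
`y_l := c • (T̃_l + ε • P T̃_l)` (`c = ½, ε = 1`: EVEN; `ε = −1`: ODD), `K♮ᴱ_l := unitK_l (coDressKBmAt (toSite r) Lc (KInvStep Lc l))` the dressed unit step kernel,
`c₄ := cE₂·Lc^{2(d+1)}`, `b̃_l` the dressed `T̃`-free source of record (`c₄ • mmRead Lc (K3OfK …(W2SymOfK …)) + cB • vh₂S`), `s_l := c • (b̃_l + ε • P b̃_l)` the halved source,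
the leg data `kc := −(c₄·(Lc^{d+1})⁻¹)`, `𝓛 ∘ 𝔹 = legStepB kc K♮ᴱ Lc`, `legChain`, `bsumPow` (MY g60 `Lin4LegTower{,Unroll}`).
* §1 THE `ε`-MEMBER's DRESSED AFFINE LAW: `unitS₂_T2RecAt_succ_eq_lin4_add` — `T̃_{l+1} = lin4 c₄ K♮ᴱ_l Lc T̃_l + b̃_l` (leaf-01's `T2HybridCellsComb.succ_eq_lin4_add_of_letters` at
  the comb data, an2's bridge `T2RecOf_comb`, letters discharged as in leaf-01's §4); `bdd₄_halfTable`; **`halfMember_succ_eq_lin4_add`** — `y_{l+1} = lin4 c₄ K♮ᴱ_l Lc y_l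
  + s_l` (leaf-01 g71's `AffineUnrollProjected.half_rec` with `hpA := Lin4ParityCovariance.sgnK_trK_lin4_unitK_coDress` — hypothesis-free).
* §2 **`locStencil₂_rdiv_halfMember_of_chain_rows`** (class `P` generic, its four rows displayed) and **`…_bdd`** (`P :=` bounded, rows automatic) — MY FILE 1
  `locStencil₂_rdiv_tower_of_window_slaved_comb` AT THE `ε`-MEMBER (`T := y`, `F := s`, `hT0 ∕ hF` discharged, `hrec := §1`): (H1♮)_δ ∧ (H2)_δ ∧ (H0)_δ ∧ (H3) ⟹
  `∀ n, LocStencil₂ (fun s ↦ rdiv (y_n s)) (M + (Cg·σ + s)·(1 − θ)⁻¹) δ`.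
* §3 **`legRows_halfMember_of_chain_rows`** (generic `d`, `c = ½`, `ε·ε = 1`) and **`legRows_halfMember_three_of_chain_rows`** (`d = 3`): THE TWO LEG LETTER ROWS `hL₁ ∧ hL₂`
  of FILE 3c ∕ PART C — `∀ l`, ONE constant `M + (Cg·σ + s)·(1 − θ)⁻¹`, rate `δ`, EXACT lambda spellings with `ε •` for `(1 : ℝ) •` — from §2 `…_bdd` ⨾ MY FILE 2
  `LegLetterParity.legRows_of_rdiv_half`.
DISPLAYED, NOT discharged: (H1♮)_δ — the k₀-fold pure leg chain `legChain kc K♮ᴱ Lc n k₀ ∘ 𝔹^{k₀}` contracts in `LocStencil₂`-at-rate-`δ` MODULO the longitudinal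
amplitude `GoodL` on bounded tables (RULING R-gan24p1-g33-2 (3) typed; the located content of (Q-L); idea-1's (Q-L-k₀) ∕ the OWNER's E44 decide it); (H2)_δ — the
window's pushed halved sources (⟸ p2's F4a rows ⨾ `locStencil₂_halfTable` ⨾ (LAY-leg), a later file); (H0)_δ — the first window; (H3) — `GoodL (rdiv ∘ y_n) σ`, the
SLAVED part (⟸ (b1) ⨾ MY g65 `LegSlotDivergenceCommute`, a later file).  Asserts NO shape of Bałaban's tables beyond these rows; discharges NOTHING of (Q-L) ∕ (C) ∕
«T2Shape» ∕ «T2Drift» ∕ (hW, hWall); (β) of record untouched; NEVER «G-an2-4 closed» as (CONV-C); NOT D1, NOT `BetaPertH`, NOT continuum, NOT Clay; not in print.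
Unit `b2b-balaban-gan24-formalise-leaf-03` (gen 67), 2026-08-23.
-/

noncomputable section
open Finset
open scoped BigOperators
open Literature.MathematicalPhysics.QuantumFieldTheory
open Literature.MathematicalPhysics.QuantumFieldTheory.Balaban1983to89
open Literature.MathematicalPhysics.QuantumFieldTheory.Balaban1983to89.Beta
open ExpKernelCalculus (MKer Site Decays)
open OneStepResolventKernel (Fib LocStencil)
open OneStepKernelFamily (KInvStep)
open AffineAveraging (box toSite unitVec)
open AveragingMixedJetTables (mixFFAt)
open SecondOrderResponse (W2SymOfK)
open BalabanCompositeJets (LocStencil₂)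
open BalabanStepJetsSucc (mmRead)
open BalabanStepW2 (K3OfK M2Of)
open Summit.QuantumFields.BalabanUV.Beta.TameKernelCalculus (trK)
open Summit.QuantumFields.BalabanUV.Beta.BorderedHessian (sgnK)
open Summit.QuantumFields.BalabanUV.Beta.HessKerDressedUnits (unitK unitS decays_unitK)
open Summit.QuantumFields.BalabanUV.Beta.SecondOrderUnits (unitM unitS₂ unitM₂)
open Summit.QuantumFields.BalabanUV.Beta.AxialDressingRooted (coDressKBmAt decays_coDressKBmAt_KInvStep)
open Summit.QuantumFields.BalabanUV.Beta.SpineRooted (T2RecAt SpureRecAt M1At T2RecOf_comb locStencil_SpureRecAt vertexFamily_M1At)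
open Summit.QuantumFields.BalabanUV.Beta.MixedJetTablesPlug (hmix_an1)
open Summit.QuantumFields.BalabanUV.Beta.GAN24.CombesThomas (sfStep smStep)
open Summit.QuantumFields.BalabanUV.Beta.GAN24.T2RecursionAffine (lin4)
open Summit.QuantumFields.BalabanUV.Beta.GAN24.Lin4Additive (lin4_bdd lin4_smul)
open Summit.QuantumFields.BalabanUV.Beta.GAN24.T2UnitSplitLevels (bdd₄_add lin4_add_of_bdd₄)
open Summit.QuantumFields.BalabanUV.Beta.GAN24.T2UnitSplitShapes (bdd₄_of_locStencil₂)
open Summit.QuantumFields.BalabanUV.Beta.GAN24.T2RecHybridSplit (bdd₄_source_of_letters)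
open Summit.QuantumFields.BalabanUV.Beta.GAN24.T2HybridCellsComb (exists_locStencil₂_unitS₂_T2RecAt succ_eq_lin4_add_of_letters)
open Summit.QuantumFields.BalabanUV.Beta.GAN24.AffineUnroll (transport)
open Summit.QuantumFields.BalabanUV.Beta.GAN24.AffineUnrollProjected (half_rec bdd₄_parity parity_add bdd₄_smul)
open Summit.QuantumFields.BalabanUV.Beta.GAN24.Lin4ParityCovariance (sgnK_trK_lin4_unitK_coDress)
open Summit.QuantumFields.BalabanUV.Beta.GAN24.Lin4LegTower (rdiv)
open Summit.QuantumFields.BalabanUV.Beta.GAN24.Lin4LegTowerUnroll (legStepB bsumPow legChain bddTab_rdiv bddTab_legStepB)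
open Summit.QuantumFields.BalabanUV.Beta.GAN24.LegTowerSlavedRows (locStencil₂_rdiv_tower_of_window_slaved_comb)
open Summit.QuantumFields.BalabanUV.Beta.GAN24.LegLetterParity (legRows_of_rdiv_half)

namespace Summit.QuantumFields.BalabanUV.Beta.GAN24.LegLetterRowsOfLegChain

variable {d : ℕ} {Lc : ℕ} [NeZero Lc] {r : Fin (d + 1) → ℕ}

/-! ## §1 The `ε`-member's dressed affine law -/
/-- [folklore] **an2's NORMALISED COMB MEMBER OBEYS THE DRESSED AFFINE LAW** `T̃_{l+1} = lin4 c₄ K♮ᴱ_l Lc T̃_l + b̃_l` (leaf-01's `succ_eq_lin4_add_of_letters` at the comb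
data through an2's bridge `T2RecOf_comb`; letters (DG) `decays_coDressKBmAt_KInvStep`, (LS) `locStencil_SpureRecAt`, (LM) `vertexFamily_M1At`, the mixed table `hmix_an1`
discharged — as in leaf-01's `T2HybridCellsComb` §4). -/
theorem unitS₂_T2RecAt_succ_eq_lin4_add (hLc : 1 ≤ Lc) (hr : r ∈ box (d + 1) Lc) (cE cVH cΛ cE₂ cB : ℝ)
    (Tc : Fin 4 → Fin 4 → Fin 4 → Fin 4 → ℝ) {vh₂S : (Fin (d + 1) → (Fin (d + 1) → ℤ) → Fin (d + 1) → (Fin (d + 1) → ℤ) → MKer (d + 1) (Fib d))}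
    (hBff : ∀ κ u κ' u' x z (α β : Fin (d + 1)), vh₂S κ u κ' u' x z (Sum.inl α) (Sum.inl β) = 0)
    (hBmm : ∀ κ u κ' u' x z (μ ν : Fin (d + 1)), vh₂S κ u κ' u' x z (Sum.inr μ) (Sum.inr ν) = 0)
    (hB : ∃ C δ : ℝ, 0 < δ ∧ LocStencil₂ vh₂S C δ) (l : ℕ) :
    unitS₂ (sfStep Lc (l + 1)) (smStep d Lc (l + 1)) (T2RecAt d Lc (toSite r) cE cVH cΛ cE₂ cB Tc vh₂S (mixFFAt (toSite r) Lc) (l + 1))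
      = lin4 (cE₂ * (Lc : ℝ) ^ (2 * (d + 1))) (unitK (sfStep Lc l) (smStep d Lc l) (coDressKBmAt (toSite r) Lc (KInvStep (d := d) Lc l))) Lc
          (unitS₂ (sfStep Lc l) (smStep d Lc l) (T2RecAt d Lc (toSite r) cE cVH cΛ cE₂ cB Tc vh₂S (mixFFAt (toSite r) Lc) l))
        + (fun κ u κ' u' => (cE₂ * (Lc : ℝ) ^ (2 * (d + 1))) • mmRead Lc (K3OfK (unitK (sfStep Lc l) (smStep d Lc l) (coDressKBmAt (toSite r) Lc (KInvStep (d := d) Lc l))) Lc (unitS (sfStep Lc l) (smStep d Lc l) (SpureRecAt d Lc (toSite r) cE cVH cΛ l)) (unitM (sfStep Lc l) (smStep d Lc l) (M1At d Lc (toSite r) cΛ l)) (W2SymOfK (unitK (sfStep Lc l) (smStep d Lc l) (coDressKBmAt (toSite r) Lc (KInvStep (d := d) Lc l))) Lc (unitS (sfStep Lc l) (smStep d Lc l) (SpureRecAt d Lc (toSite r) cE cVH cΛ l)) (unitM (sfStep Lc l) (smStep d Lc l) (M1At d Lc (toSite r) cΛ l)) 0 (unitM₂ (sfStep Lc l) (smStep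 d Lc l) (M2Of d Lc (mixFFAt (toSite r) Lc) l))) κ u κ' u') + cB • vh₂S κ u κ' u') := by
  have h := succ_eq_lin4_add_of_letters (fun j => coDressKBmAt (toSite r) Lc (KInvStep (d := d) Lc j)) (SpureRecAt d Lc (toSite r) cE cVH cΛ)
    (M1At d Lc (toSite r) cΛ) cE₂ cB Tc (vh₂S := vh₂S) (mixFF := mixFFAt (toSite r) Lc) hLc hBff hBmm
    (fun j => decays_coDressKBmAt_KInvStep (d := d) hr j) (fun j => locStencil_SpureRecAt hLc hr cE cVH cΛ j)
    (fun j => ⟨_, 1, one_pos, vertexFamily_M1At hLc hr cΛ j zero_le_one⟩) hB (hmix_an1 hLc hr) l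
  simpa only [T2RecOf_comb] using h

/-- [folklore] The `ε`-member `c • (X + ε • P X)` of a bounded bi-table is bounded (leaf-01's `bdd₄_smul ∕ bdd₄_add ∕ bdd₄_parity`). -/
theorem bdd₄_halfTable {X : (Fin (d + 1) → (Fin (d + 1) → ℤ) → Fin (d + 1) → (Fin (d + 1) → ℤ) → MKer (d + 1) (Fib d))} (hX : ∃ B : ℝ, ∀ κ u κ' u' x z a b, |X κ u κ' u' x z a b| ≤ B) (c ε : ℝ) :
    ∃ B : ℝ, ∀ κ u κ' u' x z a b, |(c • (X + ε • fun κ u κ' u' => sgnK (trK (X κ u κ' u')))) κ u κ' u' x z a b| ≤ B :=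
  bdd₄_smul c (bdd₄_add hX (bdd₄_smul ε (bdd₄_parity hX)))

/-- [folklore] **EVERY NORMALISED COMB MEMBER IS BOUNDED** (leaf-01's `exists_locStencil₂_unitS₂_T2RecAt` ⨾ `bdd₄_of_locStencil₂`). -/
theorem bdd₄_unitS₂_T2RecAt (hLc : 1 ≤ Lc) (hr : r ∈ box (d + 1) Lc) (cE cVH cΛ cE₂ cB : ℝ) (Tc : Fin 4 → Fin 4 → Fin 4 → Fin 4 → ℝ)
    {vh₂S : (Fin (d + 1) → (Fin (d + 1) → ℤ) → Fin (d + 1) → (Fin (d + 1) → ℤ) → MKer (d + 1) (Fib d))} (hB : ∃ C δ : ℝ, 0 < δ ∧ LocStencil₂ vh₂S C δ) (l : ℕ) :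
    ∃ B : ℝ, ∀ κ u κ' u' x z a b, |unitS₂ (sfStep Lc l) (smStep d Lc l) (T2RecAt d Lc (toSite r) cE cVH cΛ cE₂ cB Tc vh₂S (mixFFAt (toSite r) Lc) l) κ u κ' u' x z a b| ≤ B := by
  obtain ⟨C, δ, hδ, h⟩ := exists_locStencil₂_unitS₂_T2RecAt hLc hr cE cVH cΛ cE₂ cB Tc hB l
  exact bdd₄_of_locStencil₂ h hδ.le

/-- [folklore] **THE DRESSED SOURCE OF RECORD IS BOUNDED** at every level (leaf-01's `T2RecHybridSplit.bdd₄_source_of_letters` at the comb letters). -/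
theorem bdd₄_source_comb (hLc : 1 ≤ Lc) (hr : r ∈ box (d + 1) Lc) (cE cVH cΛ cE₂ cB : ℝ)
    (Tc : Fin 4 → Fin 4 → Fin 4 → Fin 4 → ℝ) {vh₂S : (Fin (d + 1) → (Fin (d + 1) → ℤ) → Fin (d + 1) → (Fin (d + 1) → ℤ) → MKer (d + 1) (Fib d))}
    (hBff : ∀ κ u κ' u' x z (α β : Fin (d + 1)), vh₂S κ u κ' u' x z (Sum.inl α) (Sum.inl β) = 0)
    (hBmm : ∀ κ u κ' u' x z (μ ν : Fin (d + 1)), vh₂S κ u κ' u' x z (Sum.inr μ) (Sum.inr ν) = 0)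
    (hB : ∃ C δ : ℝ, 0 < δ ∧ LocStencil₂ vh₂S C δ) (l : ℕ) :
    ∃ B : ℝ, ∀ κ u κ' u' x z a b, |(fun κ u κ' u' => (cE₂ * (Lc : ℝ) ^ (2 * (d + 1))) • mmRead Lc (K3OfK (unitK (sfStep Lc l) (smStep d Lc l) (coDressKBmAt (toSite r) Lc (KInvStep (d := d) Lc l))) Lc (unitS (sfStep Lc l) (smStep d Lc l) (SpureRecAt d Lc (toSite r) cE cVH cΛ l)) (unitM (sfStep Lc l) (smStep d Lc l) (M1At d Lc (toSite r) cΛ l)) (W2SymOfK (unitK (sfStep Lc l) (smStep d Lc l) (coDressKBmAt (toSite r) Lc (KInvStep (d := d) Lc l))) Lc (unitS (sfStep Lc l) (smStep d Lc l) (SpureRecAt d Lc (toSite r) cE cVH cΛ l)) (unitM (sfStep Lc l) (smStep d Lc l) (M1At d Lc (toSite r) cΛ l)) 0 (unitM₂ (sfStep Lc l) (smStep d Lc l) (M2Of d Lc (mixFFAt (toSite r) Lc) l))) κ u κ' u') + cB • vh₂S κ u κ' u') κ u κ' u' x z a b| ≤ B :=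
  bdd₄_source_of_letters (fun j => coDressKBmAt (toSite r) Lc (KInvStep (d := d) Lc j)) (SpureRecAt d Lc (toSite r) cE cVH cΛ) (M1At d Lc (toSite r) cΛ)
    cE₂ cB vh₂S (mixFFAt (toSite r) Lc) Tc hLc hBff hBmm (fun j => decays_coDressKBmAt_KInvStep (d := d) hr j)
    (fun j => locStencil_SpureRecAt hLc hr cE cVH cΛ j) (fun j => ⟨_, 1, one_pos, vertexFamily_M1At hLc hr cΛ j zero_le_one⟩) hB (hmix_an1 hLc hr) l

/-- NOT IN PRINT; OUR BOOKKEEPING.  **THE `ε`-MEMBER's DRESSED AFFINE LAW** `y_{l+1} = lin4 c₄ K♮ᴱ_l Lc y_l + c • (b̃_l + ε • P b̃_l)`, `y_l := c • (T̃_l + ε • P T̃_l)` — leaf-01 g71's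
`AffineUnrollProjected.half_rec` on the bounded class with the DRESSED maps, the parity `P` (class-preserving, additive) and `hpA := sgnK_trK_lin4_unitK_coDress` (the parity
commutes with the dressed one-step map — HYPOTHESIS-FREE); every `c ε`. -/
theorem halfMember_succ_eq_lin4_add (hLc : 1 ≤ Lc) (hr : r ∈ box (d + 1) Lc) (cE cVH cΛ cE₂ cB : ℝ)
    (Tc : Fin 4 → Fin 4 → Fin 4 → Fin 4 → ℝ) {vh₂S : (Fin (d + 1) → (Fin (d + 1) → ℤ) → Fin (d + 1) → (Fin (d + 1) → ℤ) → MKer (d + 1) (Fib d))}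
    (hBff : ∀ κ u κ' u' x z (α β : Fin (d + 1)), vh₂S κ u κ' u' x z (Sum.inl α) (Sum.inl β) = 0)
    (hBmm : ∀ κ u κ' u' x z (μ ν : Fin (d + 1)), vh₂S κ u κ' u' x z (Sum.inr μ) (Sum.inr ν) = 0)
    (hB : ∃ C δ : ℝ, 0 < δ ∧ LocStencil₂ vh₂S C δ) (c ε : ℝ) (l : ℕ) :
    (c • (unitS₂ (sfStep Lc (l + 1)) (smStep d Lc (l + 1)) (T2RecAt d Lc (toSite r) cE cVH cΛ cE₂ cB Tc vh₂S (mixFFAt (toSite r) Lc) (l + 1)) + ε • fun κ u κ' u' => sgnK (trK ((unitS₂ (sfStep Lc (l + 1)) (smStep d Lc (l + 1)) (T2RecAt d Lc (toSite r) cE cVH cΛ cE₂ cB Tc vh₂S (mixFFAt (toSite r) Lc) (l + 1))) κ u κ' u'))))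
      = lin4 (cE₂ * (Lc : ℝ) ^ (2 * (d + 1))) (unitK (sfStep Lc l) (smStep d Lc l) (coDressKBmAt (toSite r) Lc (KInvStep (d := d) Lc l))) Lc
          (c • (unitS₂ (sfStep Lc l) (smStep d Lc l) (T2RecAt d Lc (toSite r) cE cVH cΛ cE₂ cB Tc vh₂S (mixFFAt (toSite r) Lc) l) + ε • fun κ u κ' u' => sgnK (trK ((unitS₂ (sfStep Lc l) (smStep d Lc l) (T2RecAt d Lc (toSite r) cE cVH cΛ cE₂ cB Tc vh₂S (mixFFAt (toSite r) Lc) l)) κ u κ' u'))))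
        + (c • ((fun κ u κ' u' => (cE₂ * (Lc : ℝ) ^ (2 * (d + 1))) • mmRead Lc (K3OfK (unitK (sfStep Lc l) (smStep d Lc l) (coDressKBmAt (toSite r) Lc (KInvStep (d := d) Lc l))) Lc (unitS (sfStep Lc l) (smStep d Lc l) (SpureRecAt d Lc (toSite r) cE cVH cΛ l)) (unitM (sfStep Lc l) (smStep d Lc l) (M1At d Lc (toSite r) cΛ l)) (W2SymOfK (unitK (sfStep Lc l) (smStep d Lc l) (coDressKBmAt (toSite r) Lc (KInvStep (d := d) Lc l))) Lc (unitS (sfStep Lc l) (smStep d Lc l) (SpureRecAt d Lc (toSite r) cE cVH cΛ l)) (unitM (sfStep Lc l) (smStep d Lc l) (M1At d Lc (toSite r) cΛ l)) 0 (unitM₂ (sfStep Lc l) (smStep d Lc l) (M2Of d Lc (mixFFAt (toSite r) Lc) l))) κ u κ' u') + cB • vh₂S κ u κ' u') + ε • fun κ u κ' u' => sgnK (trK ((fun κ u κ' u' => (cE₂ * (Lc : ℝ) ^ (2 * (d + 1))) • mmRead Lc (K3OfK (unitK (sfStep Lc l) (smStep d Lc l) (coDressKBmAt (toSite r) Lc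 (KInvStep (d := d) Lc l))) Lc (unitS (sfStep Lc l) (smStep d Lc l) (SpureRecAt d Lc (toSite r) cE cVH cΛ l)) (unitM (sfStep Lc l) (smStep d Lc l) (M1At d Lc (toSite r) cΛ l)) (W2SymOfK (unitK (sfStep Lc l) (smStep d Lc l) (coDressKBmAt (toSite r) Lc (KInvStep (d := d) Lc l))) Lc (unitS (sfStep Lc l) (smStep d Lc l) (SpureRecAt d Lc (toSite r) cE cVH cΛ l)) (unitM (sfStep Lc l) (smStep d Lc l) (M1At d Lc (toSite r) cΛ l)) 0 (unitM₂ (sfStep Lc l) (smStep d Lc l) (M2Of d Lc (mixFFAt (toSite r) Lc) l))) κ u κ' u') + cB • vh₂S κ u κ' u') κ u κ' u')))) := by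
  have hT := bdd₄_unitS₂_T2RecAt hLc hr cE cVH cΛ cE₂ cB Tc hB
  have hKu : ∀ j, ∃ C δ : ℝ, 0 < δ ∧ Decays (unitK (sfStep Lc j) (smStep d Lc j) (coDressKBmAt (toSite r) Lc (KInvStep (d := d) Lc j))) C δ := fun j => by
    obtain ⟨δ, C, hδ, -, h⟩ := decays_coDressKBmAt_KInvStep (d := d) hr j
    exact ⟨_, δ, hδ, decays_unitK (sf := sfStep Lc j) (sm := smStep d Lc j) h⟩
  refine half_rec (R := ℝ)
    (A := fun j => lin4 (cE₂ * (Lc : ℝ) ^ (2 * (d + 1))) (unitK (sfStep Lc j) (smStep d Lc j) (coDressKBmAt (toSite r) Lc (KInvStep (d := d) Lc j))) Lc)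
    (P := fun X : (Fin (d + 1) → (Fin (d + 1) → ℤ) → Fin (d + 1) → (Fin (d + 1) → ℤ) → MKer (d + 1) (Fib d)) => ∃ B : ℝ, ∀ κ u κ' u' x z a b, |X κ u κ' u' x z a b| ≤ B)
    (p := fun X : (Fin (d + 1) → (Fin (d + 1) → ℤ) → Fin (d + 1) → (Fin (d + 1) → ℤ) → MKer (d + 1) (Fib d)) => fun κ u κ' u' => sgnK (trK (X κ u κ' u')))
    (x := fun j => unitS₂ (sfStep Lc j) (smStep d Lc j) (T2RecAt d Lc (toSite r) cE cVH cΛ cE₂ cB Tc vh₂S (mixFFAt (toSite r) Lc) j))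
    (b := fun j => (fun κ u κ' u' => (cE₂ * (Lc : ℝ) ^ (2 * (d + 1))) • mmRead Lc (K3OfK (unitK (sfStep Lc j) (smStep d Lc j) (coDressKBmAt (toSite r) Lc (KInvStep (d := d) Lc j))) Lc (unitS (sfStep Lc j) (smStep d Lc j) (SpureRecAt d Lc (toSite r) cE cVH cΛ j)) (unitM (sfStep Lc j) (smStep d Lc j) (M1At d Lc (toSite r) cΛ j)) (W2SymOfK (unitK (sfStep Lc j) (smStep d Lc j) (coDressKBmAt (toSite r) Lc (KInvStep (d := d) Lc j))) Lc (unitS (sfStep Lc j) (smStep d Lc j) (SpureRecAt d Lc (toSite r) cE cVH cΛ j)) (unitM (sfStep Lc j) (smStep d Lc j) (M1At d Lc (toSite r) cΛ j)) 0 (unitM₂ (sfStep Lc j) (smStep d Lc j) (M2Of d Lc (mixFFAt (toSite r) Lc) j))) κ u κ' u') + cB • vh₂S κ u κ' u'))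
    (fun _ _ => bdd₄_add) (fun r _ h => bdd₄_smul r h) (fun j Y hY => ?_) (fun j Y Z hY hZ => ?_) (fun j r Y _ => lin4_smul _ _ _ r Y)
    (fun Y hY => bdd₄_parity hY) (fun Y Z _ _ => parity_add Y Z)
    (fun j Y hY => sgnK_trK_lin4_unitK_coDress hr j (sfStep Lc j) (smStep d Lc j) (cE₂ * (Lc : ℝ) ^ (2 * (d + 1))) Y hY)
    (hT 0) (fun j => bdd₄_source_comb hLc hr cE cVH cΛ cE₂ cB Tc hBff hBmm hB j)
    (fun j => unitS₂_T2RecAt_succ_eq_lin4_add hLc hr cE cVH cΛ cE₂ cB Tc hBff hBmm hB j) c ε l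
  · obtain ⟨C, δ, hδ, h⟩ := hKu j
    exact lin4_bdd h hδ _ Lc hY
  · obtain ⟨C, δ, hδ, h⟩ := hKu j
    exact lin4_add_of_bdd₄ h hδ _ Lc hY hZ

/-! ## §2 The right-leg divergence tower of the `ε`-member, from the chain rows (MY FILE 1 at the member) -/
/-- NOT IN PRINT; OUR BOOKKEEPING.  **THE RIGHT-LEG DIVERGENCE TOWER OF THE `ε`-MEMBER IS UNIFORMLY `LocStencil₂`, MODULO THE RULED CHAIN ROWS** (class `P` generic —
MY FILE 1 `locStencil₂_rdiv_tower_of_window_slaved_comb` at `T := y`, `F := s` (the halved sources), `c m := c₄`, roots `r`; `hT0 ∕ hF` DISCHARGED (§1), `hrec := halfMember_succ_eq_lin4_add`).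
DISPLAYED: the four class rows of `P`, (H1♮)_δ — the k₀-fold pure leg chain on k₀-fold block sums contracts at rate `δ` MODULO the longitudinal amplitude `GoodL` on bounded
`W ∈ P` —, (H2)_δ — the window's pushed halved sources —, (H0)_δ — the first window —, (H3) — the slaved part `GoodL (rdiv ∘ y_n) σ`.
THEN `∀ n, LocStencil₂ (fun s ↦ rdiv (y_n s)) (M + (Cg·σ + s)·(1 − θ)⁻¹) δ`.  Nothing of (H1♮) ∕ (H2) ∕ (H0) ∕ (H3) is claimed. -/
theorem locStencil₂_rdiv_halfMember_of_chain_rows (hLc : 1 ≤ Lc) (hr : r ∈ box (d + 1) Lc) (cE cVH cΛ cE₂ cB : ℝ)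
    (Tc : Fin 4 → Fin 4 → Fin 4 → Fin 4 → ℝ) {vh₂S : (Fin (d + 1) → (Fin (d + 1) → ℤ) → Fin (d + 1) → (Fin (d + 1) → ℤ) → MKer (d + 1) (Fib d))}
    (hBff : ∀ κ u κ' u' x z (α β : Fin (d + 1)), vh₂S κ u κ' u' x z (Sum.inl α) (Sum.inl β) = 0)
    (hBmm : ∀ κ u κ' u' x z (μ ν : Fin (d + 1)), vh₂S κ u κ' u' x z (Sum.inr μ) (Sum.inr ν) = 0)
    (hB : ∃ C δ : ℝ, 0 < δ ∧ LocStencil₂ vh₂S C δ) (c ε : ℝ)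
    (P : (Fin (d + 1) → (Fin (d + 1) → ℤ) → Fin (d + 1) → (Fin (d + 1) → ℤ) → MKer (d + 1) (Fib d)) → Prop)
    (hP0 : P (fun κ u κ' u' => rdiv ((c • (unitS₂ (sfStep Lc 0) (smStep d Lc 0) (T2RecAt d Lc (toSite r) cE cVH cΛ cE₂ cB Tc vh₂S (mixFFAt (toSite r) Lc) 0) + ε • fun κ u κ' u' => sgnK (trK ((unitS₂ (sfStep Lc 0) (smStep d Lc 0) (T2RecAt d Lc (toSite r) cE cVH cΛ cE₂ cB Tc vh₂S (mixFFAt (toSite r) Lc) 0)) κ u κ' u')))) κ u κ' u')))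
    (hPF : ∀ m, P (fun κ u κ' u' => rdiv ((c • ((fun κ u κ' u' => (cE₂ * (Lc : ℝ) ^ (2 * (d + 1))) • mmRead Lc (K3OfK (unitK (sfStep Lc m) (smStep d Lc m) (coDressKBmAt (toSite r) Lc (KInvStep (d := d) Lc m))) Lc (unitS (sfStep Lc m) (smStep d Lc m) (SpureRecAt d Lc (toSite r) cE cVH cΛ m)) (unitM (sfStep Lc m) (smStep d Lc m) (M1At d Lc (toSite r) cΛ m)) (W2SymOfK (unitK (sfStep Lc m) (smStep d Lc m) (coDressKBmAt (toSite r) Lc (KInvStep (d := d) Lc m))) Lc (unitS (sfStep Lc m) (smStep d Lc m) (SpureRecAt d Lc (toSite r) cE cVH cΛ m)) (unitM (sfStep Lc m) (smStep d Lc m) (M1At d Lc (toSite r) cΛ m)) 0 (unitM₂ (sfStep Lc m) (smStep d Lc m) (M2Of d Lc (mixFFAt (toSite r) Lc) m))) κ u κ' u') + cB • vh₂S κ u κ' u') + ε • fun κ u κ' u' => sgnK (trK ((fun κ u κ' u' => (cE₂ * (Lc : ℝ) ^ (2 * (d + 1))) • mmRead Lc (K3OfK (unitK (sfStep Lc m)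 (smStep d Lc m) (coDressKBmAt (toSite r) Lc (KInvStep (d := d) Lc m))) Lc (unitS (sfStep Lc m) (smStep d Lc m) (SpureRecAt d Lc (toSite r) cE cVH cΛ m)) (unitM (sfStep Lc m) (smStep d Lc m) (M1At d Lc (toSite r) cΛ m)) (W2SymOfK (unitK (sfStep Lc m) (smStep d Lc m) (coDressKBmAt (toSite r) Lc (KInvStep (d := d) Lc m))) Lc (unitS (sfStep Lc m) (smStep d Lc m) (SpureRecAt d Lc (toSite r) cE cVH cΛ m)) (unitM (sfStep Lc m) (smStep d Lc m) (M1At d Lc (toSite r) cΛ m)) 0 (unitM₂ (sfStep Lc m) (smStep d Lc m) (M2Of d Lc (mixFFAt (toSite r) Lc) m))) κ u κ' u') + cB • vh₂S κ u κ' u') κ u κ' u')))) κ u κ' u')))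
    (hPadd : ∀ X Y, P X → P Y → P (X + Y))
    (hPA : ∀ j (W : (Fin (d + 1) → (Fin (d + 1) → ℤ) → Fin (d + 1) → (Fin (d + 1) → ℤ) → MKer (d + 1) (Fib d))), P W →
      (∃ B : ℝ, ∀ κ u κ' u' x z a b, |W κ u κ' u' x z a b| ≤ B) →
        P (legStepB (fun _ : ℕ => -((cE₂ * (Lc : ℝ) ^ (2 * (d + 1))) * ((Lc : ℝ) ^ (d + 1))⁻¹))
          (fun m => unitK (sfStep Lc m) (smStep d Lc m) (coDressKBmAt (toSite r) Lc (KInvStep (d := d) Lc m))) Lc j W))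
    {GoodL : (Fin (d + 1) → (Fin (d + 1) → ℤ) → Fin (d + 1) → (Fin (d + 1) → ℤ) → MKer (d + 1) (Fib d)) → ℝ → Prop} (δ : ℝ)
    {k₀ : ℕ} (hk : 0 < k₀) {θ Cg s M σ : ℝ} (hθ0 : 0 ≤ θ) (hθ1 : θ < 1) (hCg : 0 ≤ Cg) (hs : 0 ≤ s) (hM : 0 ≤ M) (hσ : 0 ≤ σ)
    (H1 : ∀ n (W : (Fin (d + 1) → (Fin (d + 1) → ℤ) → Fin (d + 1) → (Fin (d + 1) → ℤ) → MKer (d + 1) (Fib d))) (C g : ℝ), P W →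
      (∃ B : ℝ, ∀ κ u κ' u' x z a b, |W κ u κ' u' x z a b| ≤ B) → LocStencil₂ W C δ → GoodL W g →
        LocStencil₂ (legChain (fun _ : ℕ => -((cE₂ * (Lc : ℝ) ^ (2 * (d + 1))) * ((Lc : ℝ) ^ (d + 1))⁻¹))
          (fun m => unitK (sfStep Lc m) (smStep d Lc m) (coDressKBmAt (toSite r) Lc (KInvStep (d := d) Lc m))) Lc n k₀
          (fun κ u κ' u' => bsumPow Lc k₀ (W κ u κ' u'))) (θ * C + Cg * g) δ)
    (H2 : ∀ n, LocStencil₂ (∑ m ∈ Finset.range k₀, transport (legStepB (fun _ : ℕ => -((cE₂ * (Lc : ℝ) ^ (2 * (d + 1))) * ((Lc : ℝ) ^ (d + 1))⁻¹))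
      (fun m => unitK (sfStep Lc m) (smStep d Lc m) (coDressKBmAt (toSite r) Lc (KInvStep (d := d) Lc m))) Lc) (n + m + 1) (k₀ - 1 - m)
      (fun κ u κ' u' => rdiv ((c • ((fun κ u κ' u' => (cE₂ * (Lc : ℝ) ^ (2 * (d + 1))) • mmRead Lc (K3OfK (unitK (sfStep Lc (n + m)) (smStep d Lc (n + m)) (coDressKBmAt (toSite r) Lc (KInvStep (d := d) Lc (n + m)))) Lc (unitS (sfStep Lc (n + m)) (smStep d Lc (n + m)) (SpureRecAt d Lc (toSite r) cE cVH cΛ (n + m))) (unitM (sfStep Lc (n + m)) (smStep d Lc (n + m)) (M1At d Lc (toSite r) cΛ (n + m))) (W2SymOfK (unitK (sfStep Lc (n + m)) (smStep d Lc (n + m)) (coDressKBmAt (toSite r) Lc (KInvStep (d := d) Lc (n + m)))) Lc (unitS (sfStep Lc (n + m)) (smStep d Lc (n + m)) (SpureRecAt d Lc (toSite r) cE cVH cΛ (n + m))) (unitM (sfStep Lc (n + m)) (smStep d Lc (n + m)) (M1At d Lc (toSite r) cΛ (n + m))) 0 (unitM₂ (sfStep Lc (n + m)) (smStep d Lc (n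 + m)) (M2Of d Lc (mixFFAt (toSite r) Lc) (n + m)))) κ u κ' u') + cB • vh₂S κ u κ' u') + ε • fun κ u κ' u' => sgnK (trK ((fun κ u κ' u' => (cE₂ * (Lc : ℝ) ^ (2 * (d + 1))) • mmRead Lc (K3OfK (unitK (sfStep Lc (n + m)) (smStep d Lc (n + m)) (coDressKBmAt (toSite r) Lc (KInvStep (d := d) Lc (n + m)))) Lc (unitS (sfStep Lc (n + m)) (smStep d Lc (n + m)) (SpureRecAt d Lc (toSite r) cE cVH cΛ (n + m))) (unitM (sfStep Lc (n + m)) (smStep d Lc (n + m)) (M1At d Lc (toSite r) cΛ (n + m))) (W2SymOfK (unitK (sfStep Lc (n + m)) (smStep d Lc (n + m)) (coDressKBmAt (toSite r) Lc (KInvStep (d := d) Lc (n + m)))) Lc (unitS (sfStep Lc (n + m)) (smStep d Lc (n + m)) (SpureRecAt d Lc (toSite r) cE cVH cΛ (n + m))) (unitM (sfStep Lc (n + m)) (smStep d Lc (n + m)) (M1At d Lc (toSite r) cΛ (n + m))) 0 (unitM₂ (sfStep Lc (n + m)) (smStep d Lc (n + m)) (M2Of d Lc (mixFFAt (toSite r)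 Lc) (n + m)))) κ u κ' u') + cB • vh₂S κ u κ' u') κ u κ' u')))) κ u κ' u'))) s δ)
    (H0 : ∀ i, i < k₀ → LocStencil₂ (fun κ u κ' u' => rdiv ((c • (unitS₂ (sfStep Lc i) (smStep d Lc i) (T2RecAt d Lc (toSite r) cE cVH cΛ cE₂ cB Tc vh₂S (mixFFAt (toSite r) Lc) i) + ε • fun κ u κ' u' => sgnK (trK ((unitS₂ (sfStep Lc i) (smStep d Lc i) (T2RecAt d Lc (toSite r) cE cVH cΛ cE₂ cB Tc vh₂S (mixFFAt (toSite r) Lc) i)) κ u κ' u')))) κ u κ' u')) M δ)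
    (H3 : ∀ n, GoodL (fun κ u κ' u' => rdiv ((c • (unitS₂ (sfStep Lc n) (smStep d Lc n) (T2RecAt d Lc (toSite r) cE cVH cΛ cE₂ cB Tc vh₂S (mixFFAt (toSite r) Lc) n) + ε • fun κ u κ' u' => sgnK (trK ((unitS₂ (sfStep Lc n) (smStep d Lc n) (T2RecAt d Lc (toSite r) cE cVH cΛ cE₂ cB Tc vh₂S (mixFFAt (toSite r) Lc) n)) κ u κ' u')))) κ u κ' u')) σ) (n : ℕ) :
    LocStencil₂ (fun κ u κ' u' => rdiv ((c • (unitS₂ (sfStep Lc n) (smStep d Lc n) (T2RecAt d Lc (toSite r) cE cVH cΛ cE₂ cB Tc vh₂S (mixFFAt (toSite r) Lc) n) + ε • fun κ u κ' u' => sgnK (trK ((unitS₂ (sfStep Lc n) (smStep d Lc n) (T2RecAt d Lc (toSite r) cE cVH cΛ cE₂ cB Tc vh₂S (mixFFAt (toSite r) Lc) n)) κ u κ' u')))) κ u κ' u')) (M + (Cg * σ + s) * (1 - θ)⁻¹) δ :=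
  locStencil₂_rdiv_tower_of_window_slaved_comb hr (fun _ => cE₂ * (Lc : ℝ) ^ (2 * (d + 1)))
    (T := fun l => (c • (unitS₂ (sfStep Lc l) (smStep d Lc l) (T2RecAt d Lc (toSite r) cE cVH cΛ cE₂ cB Tc vh₂S (mixFFAt (toSite r) Lc) l) + ε • fun κ u κ' u' => sgnK (trK ((unitS₂ (sfStep Lc l) (smStep d Lc l) (T2RecAt d Lc (toSite r) cE cVH cΛ cE₂ cB Tc vh₂S (mixFFAt (toSite r) Lc) l)) κ u κ' u')))))
    (F := fun l => (c • ((fun κ u κ' u' => (cE₂ * (Lc : ℝ) ^ (2 * (d + 1))) • mmRead Lc (K3OfK (unitK (sfStep Lc l) (smStep d Lc l) (coDressKBmAt (toSite r) Lc (KInvStep (d := d) Lc l))) Lc (unitS (sfStep Lc l) (smStep d Lc l) (SpureRecAt d Lc (toSite r) cE cVH cΛ l)) (unitM (sfStep Lc l) (smStep d Lc l) (M1At d Lc (toSite r) cΛ l)) (W2SymOfK (unitK (sfStep Lc l) (smStep d Lc l) (coDressKBmAt (toSite r) Lc (KInvStep (d := d) Lc l))) Lc (unitS (sfStep Lc l)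 (smStep d Lc l) (SpureRecAt d Lc (toSite r) cE cVH cΛ l)) (unitM (sfStep Lc l) (smStep d Lc l) (M1At d Lc (toSite r) cΛ l)) 0 (unitM₂ (sfStep Lc l) (smStep d Lc l) (M2Of d Lc (mixFFAt (toSite r) Lc) l))) κ u κ' u') + cB • vh₂S κ u κ' u') + ε • fun κ u κ' u' => sgnK (trK ((fun κ u κ' u' => (cE₂ * (Lc : ℝ) ^ (2 * (d + 1))) • mmRead Lc (K3OfK (unitK (sfStep Lc l) (smStep d Lc l) (coDressKBmAt (toSite r) Lc (KInvStep (d := d) Lc l))) Lc (unitS (sfStep Lc l) (smStep d Lc l) (SpureRecAt d Lc (toSite r) cE cVH cΛ l)) (unitM (sfStep Lc l) (smStep d Lc l) (M1At d Lc (toSite r) cΛ l)) (W2SymOfK (unitK (sfStep Lc l) (smStep d Lc l) (coDressKBmAt (toSite r) Lc (KInvStep (d := d) Lc l))) Lc (unitS (sfStep Lc l) (smStep d Lc l) (SpureRecAt d Lc (toSite r) cE cVH cΛ l)) (unitM (sfStep Lc l) (smStep d Lc l) (M1At d Lc (toSite r) cΛ l)) 0 (unitM₂ (sfStep Lc l)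 (smStep d Lc l) (M2Of d Lc (mixFFAt (toSite r) Lc) l))) κ u κ' u') + cB • vh₂S κ u κ' u') κ u κ' u')))))
    (bdd₄_halfTable (bdd₄_unitS₂_T2RecAt hLc hr cE cVH cΛ cE₂ cB Tc hB 0) c ε)
    (fun m => bdd₄_halfTable (bdd₄_source_comb hLc hr cE cVH cΛ cE₂ cB Tc hBff hBmm hB m) c ε)
    (fun m => halfMember_succ_eq_lin4_add hLc hr cE cVH cΛ cE₂ cB Tc hBff hBmm hB c ε m)
    P hP0 hPF hPadd hPA δ hk hθ0 hθ1 hCg hs hM hσ H1 H2 H0 H3 n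

/-- NOT IN PRINT; OUR BOOKKEEPING.  **THE SAME ON THE BOUNDED CLASS** (`P :=` «entrywise bounded», RULING -2 (3)'s `bdd₄`: the four class rows are AUTOMATIC — g60 part 3's
`bddTab_rdiv ∕ bddTab_legStepB`, leaf-01's `bdd₄_add`), so EXACTLY (H1♮)_δ on bounded tables, (H2)_δ, (H0)_δ, (H3) remain displayed. -/
theorem locStencil₂_rdiv_halfMember_of_chain_rows_bdd (hLc : 1 ≤ Lc) (hr : r ∈ box (d + 1) Lc) (cE cVH cΛ cE₂ cB : ℝ)
    (Tc : Fin 4 → Fin 4 → Fin 4 → Fin 4 → ℝ) {vh₂S : (Fin (d + 1) → (Fin (d + 1) → ℤ) → Fin (d + 1) → (Fin (d + 1) → ℤ) → MKer (d + 1) (Fib d))}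
    (hBff : ∀ κ u κ' u' x z (α β : Fin (d + 1)), vh₂S κ u κ' u' x z (Sum.inl α) (Sum.inl β) = 0)
    (hBmm : ∀ κ u κ' u' x z (μ ν : Fin (d + 1)), vh₂S κ u κ' u' x z (Sum.inr μ) (Sum.inr ν) = 0)
    (hB : ∃ C δ : ℝ, 0 < δ ∧ LocStencil₂ vh₂S C δ) (c ε : ℝ)
    {GoodL : (Fin (d + 1) → (Fin (d + 1) → ℤ) → Fin (d + 1) → (Fin (d + 1) → ℤ) → MKer (d + 1) (Fib d)) → ℝ → Prop} (δ : ℝ)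
    {k₀ : ℕ} (hk : 0 < k₀) {θ Cg s M σ : ℝ} (hθ0 : 0 ≤ θ) (hθ1 : θ < 1) (hCg : 0 ≤ Cg) (hs : 0 ≤ s) (hM : 0 ≤ M) (hσ : 0 ≤ σ)
    (H1 : ∀ n (W : (Fin (d + 1) → (Fin (d + 1) → ℤ) → Fin (d + 1) → (Fin (d + 1) → ℤ) → MKer (d + 1) (Fib d))) (C g : ℝ), (∃ B : ℝ, ∀ κ u κ' u' x z a b, |W κ u κ' u' x z a b| ≤ B) → LocStencil₂ W C δ → GoodL W g →
        LocStencil₂ (legChain (fun _ : ℕ => -((cE₂ * (Lc : ℝ) ^ (2 * (d + 1))) * ((Lc : ℝ) ^ (d + 1))⁻¹))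
          (fun m => unitK (sfStep Lc m) (smStep d Lc m) (coDressKBmAt (toSite r) Lc (KInvStep (d := d) Lc m))) Lc n k₀
          (fun κ u κ' u' => bsumPow Lc k₀ (W κ u κ' u'))) (θ * C + Cg * g) δ)
    (H2 : ∀ n, LocStencil₂ (∑ m ∈ Finset.range k₀, transport (legStepB (fun _ : ℕ => -((cE₂ * (Lc : ℝ) ^ (2 * (d + 1))) * ((Lc : ℝ) ^ (d + 1))⁻¹))
      (fun m => unitK (sfStep Lc m) (smStep d Lc m) (coDressKBmAt (toSite r) Lc (KInvStep (d := d) Lc m))) Lc) (n + m + 1) (k₀ - 1 - m)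
      (fun κ u κ' u' => rdiv ((c • ((fun κ u κ' u' => (cE₂ * (Lc : ℝ) ^ (2 * (d + 1))) • mmRead Lc (K3OfK (unitK (sfStep Lc (n + m)) (smStep d Lc (n + m)) (coDressKBmAt (toSite r) Lc (KInvStep (d := d) Lc (n + m)))) Lc (unitS (sfStep Lc (n + m)) (smStep d Lc (n + m)) (SpureRecAt d Lc (toSite r) cE cVH cΛ (n + m))) (unitM (sfStep Lc (n + m)) (smStep d Lc (n + m)) (M1At d Lc (toSite r) cΛ (n + m))) (W2SymOfK (unitK (sfStep Lc (n + m)) (smStep d Lc (n + m)) (coDressKBmAt (toSite r) Lc (KInvStep (d := d) Lc (n + m)))) Lc (unitS (sfStep Lc (n + m)) (smStep d Lc (n + m)) (SpureRecAt d Lc (toSite r) cE cVH cΛ (n + m))) (unitM (sfStep Lc (n + m)) (smStep d Lc (n + m)) (M1At d Lc (toSite r) cΛ (n + m))) 0 (unitM₂ (sfStep Lc (n + m)) (smStep d Lc (n + m)) (M2Of d Lc (mixFFAt (toSite r) Lc) (n + m)))) κ u κ' u') + cB • vh₂S κ u κ' u') + ε • fun κ u κ' u' => sgnK (trK ((fun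 κ u κ' u' => (cE₂ * (Lc : ℝ) ^ (2 * (d + 1))) • mmRead Lc (K3OfK (unitK (sfStep Lc (n + m)) (smStep d Lc (n + m)) (coDressKBmAt (toSite r) Lc (KInvStep (d := d) Lc (n + m)))) Lc (unitS (sfStep Lc (n + m)) (smStep d Lc (n + m)) (SpureRecAt d Lc (toSite r) cE cVH cΛ (n + m))) (unitM (sfStep Lc (n + m)) (smStep d Lc (n + m)) (M1At d Lc (toSite r) cΛ (n + m))) (W2SymOfK (unitK (sfStep Lc (n + m)) (smStep d Lc (n + m)) (coDressKBmAt (toSite r) Lc (KInvStep (d := d) Lc (n + m)))) Lc (unitS (sfStep Lc (n + m)) (smStep d Lc (n + m)) (SpureRecAt d Lc (toSite r) cE cVH cΛ (n + m))) (unitM (sfStep Lc (n + m)) (smStep d Lc (n + m)) (M1At d Lc (toSite r) cΛ (n + m))) 0 (unitM₂ (sfStep Lc (n + m)) (smStep d Lc (n + m)) (M2Of d Lc (mixFFAt (toSite r) Lc) (n + m)))) κ u κ' u') + cB • vh₂S κ u κ' u') κ u κ' u')))) κ u κ' u'))) s δ)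
    (H0 : ∀ i, i < k₀ → LocStencil₂ (fun κ u κ' u' => rdiv ((c • (unitS₂ (sfStep Lc i) (smStep d Lc i) (T2RecAt d Lc (toSite r) cE cVH cΛ cE₂ cB Tc vh₂S (mixFFAt (toSite r) Lc) i) + ε • fun κ u κ' u' => sgnK (trK ((unitS₂ (sfStep Lc i) (smStep d Lc i) (T2RecAt d Lc (toSite r) cE cVH cΛ cE₂ cB Tc vh₂S (mixFFAt (toSite r) Lc) i)) κ u κ' u')))) κ u κ' u')) M δ)
    (H3 : ∀ n, GoodL (fun κ u κ' u' => rdiv ((c • (unitS₂ (sfStep Lc n) (smStep d Lc n) (T2RecAt d Lc (toSite r) cE cVH cΛ cE₂ cB Tc vh₂S (mixFFAt (toSite r) Lc) n) + ε • fun κ u κ' u' => sgnK (trK ((unitS₂ (sfStep Lc n) (smStep d Lc n) (T2RecAt d Lc (toSite r) cE cVH cΛ cE₂ cB Tc vh₂S (mixFFAt (toSite r) Lc) n)) κ u κ' u')))) κ u κ' u')) σ) (n : ℕ) :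
    LocStencil₂ (fun κ u κ' u' => rdiv ((c • (unitS₂ (sfStep Lc n) (smStep d Lc n) (T2RecAt d Lc (toSite r) cE cVH cΛ cE₂ cB Tc vh₂S (mixFFAt (toSite r) Lc) n) + ε • fun κ u κ' u' => sgnK (trK ((unitS₂ (sfStep Lc n) (smStep d Lc n) (T2RecAt d Lc (toSite r) cE cVH cΛ cE₂ cB Tc vh₂S (mixFFAt (toSite r) Lc) n)) κ u κ' u')))) κ u κ' u')) (M + (Cg * σ + s) * (1 - θ)⁻¹) δ := by
  have hK : ∀ m, ∃ δ C : ℝ, 0 < δ ∧ Decays (unitK (sfStep Lc m) (smStep d Lc m) (coDressKBmAt (toSite r) Lc (KInvStep (d := d) Lc m))) C δ := by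
    intro m
    obtain ⟨δK, CK, hδK, -, hG⟩ := decays_coDressKBmAt_KInvStep (d := d) hr m
    exact ⟨δK, _, hδK, decays_unitK hG⟩
  exact locStencil₂_rdiv_halfMember_of_chain_rows hLc hr cE cVH cΛ cE₂ cB Tc hBff hBmm hB c ε
    (fun W => ∃ B : ℝ, ∀ κ u κ' u' x z a b, |W κ u κ' u' x z a b| ≤ B)
    (bddTab_rdiv (bdd₄_halfTable (bdd₄_unitS₂_T2RecAt hLc hr cE cVH cΛ cE₂ cB Tc hB 0) c ε))
    (fun m => bddTab_rdiv (bdd₄_halfTable (bdd₄_source_comb hLc hr cE cVH cΛ cE₂ cB Tc hBff hBmm hB m) c ε))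
    (fun _ _ hX hY => bdd₄_add hX hY) (fun j _ hW _ => bddTab_legStepB hK j hW) δ hk hθ0 hθ1 hCg hs hM hσ
    (fun n W C g _ hW hC hg => H1 n W C g hW hC hg) H2 H0 H3 n

/-! ## §3 The two leg letter rows of the `ε`-member (`c = ½`, `ε·ε = 1`), generic `d` and `d = 3` -/
/-- NOT IN PRINT; OUR BOOKKEEPING.  **THE TWO LEG LETTER ROWS `hL₁ ∧ hL₂` OF THE `ε`-MEMBER `½ • (T̃ + ε • P T̃)` (`ε·ε = 1`) FROM THE RULED CHAIN ROWS** — §2 `…_bdd` (`∀ n`)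
⨾ MY FILE 2 `LegLetterParity.legRows_of_rdiv_half` (one leg tower per parity member): `∀ l`, ONE constant `M + (Cg·σ + s)·(1 − θ)⁻¹`, rate `δ`, in FILE 3c's ∕ PART C's EXACT
lambda spellings (`ε •` where they have `(1 : ℝ) •`).  DISPLAYED: (H1♮)_δ on bounded tables, (H2)_δ, (H0)_δ, (H3).  This is where row L11 (Q-L) stands after this file:
the LEG letter rows ⟸ ONE chain-contraction display (the ruled (H1)^{⊥} with the longitudinal amplitude priced by `Cg`) + the window source rows + the first window + the
slaved longitudinal row. -/
theorem legRows_halfMember_of_chain_rows (hLc : 1 ≤ Lc) (hr : r ∈ box (d + 1) Lc) (cE cVH cΛ cE₂ cB : ℝ)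
    (Tc : Fin 4 → Fin 4 → Fin 4 → Fin 4 → ℝ) {vh₂S : (Fin (d + 1) → (Fin (d + 1) → ℤ) → Fin (d + 1) → (Fin (d + 1) → ℤ) → MKer (d + 1) (Fib d))}
    (hBff : ∀ κ u κ' u' x z (α β : Fin (d + 1)), vh₂S κ u κ' u' x z (Sum.inl α) (Sum.inl β) = 0)
    (hBmm : ∀ κ u κ' u' x z (μ ν : Fin (d + 1)), vh₂S κ u κ' u' x z (Sum.inr μ) (Sum.inr ν) = 0)
    (hB : ∃ C δ : ℝ, 0 < δ ∧ LocStencil₂ vh₂S C δ) {ε : ℝ} (hε : ε * ε = 1)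
    {GoodL : (Fin (d + 1) → (Fin (d + 1) → ℤ) → Fin (d + 1) → (Fin (d + 1) → ℤ) → MKer (d + 1) (Fib d)) → ℝ → Prop} (δ : ℝ)
    {k₀ : ℕ} (hk : 0 < k₀) {θ Cg s M σ : ℝ} (hθ0 : 0 ≤ θ) (hθ1 : θ < 1) (hCg : 0 ≤ Cg) (hs : 0 ≤ s) (hM : 0 ≤ M) (hσ : 0 ≤ σ)
    (H1 : ∀ n (W : (Fin (d + 1) → (Fin (d + 1) → ℤ) → Fin (d + 1) → (Fin (d + 1) → ℤ) → MKer (d + 1) (Fib d))) (C g : ℝ), (∃ B : ℝ, ∀ κ u κ' u' x z a b, |W κ u κ' u' x z a b| ≤ B) → LocStencil₂ W C δ → GoodL W g →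
        LocStencil₂ (legChain (fun _ : ℕ => -((cE₂ * (Lc : ℝ) ^ (2 * (d + 1))) * ((Lc : ℝ) ^ (d + 1))⁻¹))
          (fun m => unitK (sfStep Lc m) (smStep d Lc m) (coDressKBmAt (toSite r) Lc (KInvStep (d := d) Lc m))) Lc n k₀
          (fun κ u κ' u' => bsumPow Lc k₀ (W κ u κ' u'))) (θ * C + Cg * g) δ)
    (H2 : ∀ n, LocStencil₂ (∑ m ∈ Finset.range k₀, transport (legStepB (fun _ : ℕ => -((cE₂ * (Lc : ℝ) ^ (2 * (d + 1))) * ((Lc : ℝ) ^ (d + 1))⁻¹))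
      (fun m => unitK (sfStep Lc m) (smStep d Lc m) (coDressKBmAt (toSite r) Lc (KInvStep (d := d) Lc m))) Lc) (n + m + 1) (k₀ - 1 - m)
      (fun κ u κ' u' => rdiv ((((1 : ℝ) / 2) • ((fun κ u κ' u' => (cE₂ * (Lc : ℝ) ^ (2 * (d + 1))) • mmRead Lc (K3OfK (unitK (sfStep Lc (n + m)) (smStep d Lc (n + m)) (coDressKBmAt (toSite r) Lc (KInvStep (d := d) Lc (n + m)))) Lc (unitS (sfStep Lc (n + m)) (smStep d Lc (n + m)) (SpureRecAt d Lc (toSite r) cE cVH cΛ (n + m))) (unitM (sfStep Lc (n + m)) (smStep d Lc (n + m)) (M1At d Lc (toSite r) cΛ (n + m))) (W2SymOfK (unitK (sfStep Lc (n + m)) (smStep d Lc (n + m)) (coDressKBmAt (toSite r) Lc (KInvStep (d := d) Lc (n + m)))) Lc (unitS (sfStep Lc (n + m)) (smStep d Lc (n + m)) (SpureRecAt d Lc (toSite r) cE cVH cΛ (n + m))) (unitM (sfStep Lc (n + m)) (smStep d Lc (n + m)) (M1At d Lc (toSite r) cΛ (n + m))) 0 (unitM₂ (sfStep Lc (n +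 m)) (smStep d Lc (n + m)) (M2Of d Lc (mixFFAt (toSite r) Lc) (n + m)))) κ u κ' u') + cB • vh₂S κ u κ' u') + ε • fun κ u κ' u' => sgnK (trK ((fun κ u κ' u' => (cE₂ * (Lc : ℝ) ^ (2 * (d + 1))) • mmRead Lc (K3OfK (unitK (sfStep Lc (n + m)) (smStep d Lc (n + m)) (coDressKBmAt (toSite r) Lc (KInvStep (d := d) Lc (n + m)))) Lc (unitS (sfStep Lc (n + m)) (smStep d Lc (n + m)) (SpureRecAt d Lc (toSite r) cE cVH cΛ (n + m))) (unitM (sfStep Lc (n + m)) (smStep d Lc (n + m)) (M1At d Lc (toSite r) cΛ (n + m))) (W2SymOfK (unitK (sfStep Lc (n + m)) (smStep d Lc (n + m)) (coDressKBmAt (toSite r) Lc (KInvStep (d := d) Lc (n + m)))) Lc (unitS (sfStep Lc (n + m)) (smStep d Lc (n + m)) (SpureRecAt d Lc (toSite r) cE cVH cΛ (n + m))) (unitM (sfStep Lc (n + m)) (smStep d Lc (n + m)) (M1At d Lc (toSite r) cΛ (n + m))) 0 (unitM₂ (sfStep Lc (n + m)) (smStep d Lc (n + m)) (M2Of d Lc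 (mixFFAt (toSite r) Lc) (n + m)))) κ u κ' u') + cB • vh₂S κ u κ' u') κ u κ' u')))) κ u κ' u'))) s δ)
    (H0 : ∀ i, i < k₀ → LocStencil₂ (fun κ u κ' u' => rdiv ((((1 : ℝ) / 2) • (unitS₂ (sfStep Lc i) (smStep d Lc i) (T2RecAt d Lc (toSite r) cE cVH cΛ cE₂ cB Tc vh₂S (mixFFAt (toSite r) Lc) i) + ε • fun κ u κ' u' => sgnK (trK ((unitS₂ (sfStep Lc i) (smStep d Lc i) (T2RecAt d Lc (toSite r) cE cVH cΛ cE₂ cB Tc vh₂S (mixFFAt (toSite r) Lc) i)) κ u κ' u')))) κ u κ' u')) M δ)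
    (H3 : ∀ n, GoodL (fun κ u κ' u' => rdiv ((((1 : ℝ) / 2) • (unitS₂ (sfStep Lc n) (smStep d Lc n) (T2RecAt d Lc (toSite r) cE cVH cΛ cE₂ cB Tc vh₂S (mixFFAt (toSite r) Lc) n) + ε • fun κ u κ' u' => sgnK (trK ((unitS₂ (sfStep Lc n) (smStep d Lc n) (T2RecAt d Lc (toSite r) cE cVH cΛ cE₂ cB Tc vh₂S (mixFFAt (toSite r) Lc) n)) κ u κ' u')))) κ u κ' u')) σ) :
    (∀ l, LocStencil₂ (fun κ u κ' u' => fun (p z : Fin (d + 1) → ℤ) (_ : Fib d) (b : Fib d) =>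
      ∑ β : Fin (d + 1), ((((1 : ℝ) / 2) • (unitS₂ (sfStep Lc l) (smStep d Lc l) (T2RecAt d Lc (toSite r) cE cVH cΛ cE₂ cB Tc vh₂S (mixFFAt (toSite r) Lc) l) + ε • fun κ u κ' u' => sgnK (trK ((unitS₂ (sfStep Lc l) (smStep d Lc l) (T2RecAt d Lc (toSite r) cE cVH cΛ cE₂ cB Tc vh₂S (mixFFAt (toSite r) Lc) l)) κ u κ' u')))) κ u κ' u' p z (Sum.inl β) b
        - (((1 : ℝ) / 2) • (unitS₂ (sfStep Lc l) (smStep d Lc l) (T2RecAt d Lc (toSite r) cE cVH cΛ cE₂ cB Tc vh₂S (mixFFAt (toSite r) Lc) l) + ε • fun κ u κ' u' => sgnK (trK ((unitS₂ (sfStep Lc l) (smStep d Lc l) (T2RecAt d Lc (toSite r) cE cVH cΛ cE₂ cB Tc vh₂S (mixFFAt (toSite r) Lc) l)) κ u κ' u')))) κ u κ' u' (p - unitVec β) z (Sum.inl β) b)) (M + (Cg * σ + s) * (1 - θ)⁻¹) δ) ∧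
    (∀ l, LocStencil₂ (fun κ u κ' u' => fun (x p : Fin (d + 1) → ℤ) (a : Fib d) (_ : Fib d) =>
      ∑ β : Fin (d + 1), ((((1 : ℝ) / 2) • (unitS₂ (sfStep Lc l) (smStep d Lc l) (T2RecAt d Lc (toSite r) cE cVH cΛ cE₂ cB Tc vh₂S (mixFFAt (toSite r) Lc) l) + ε • fun κ u κ' u' => sgnK (trK ((unitS₂ (sfStep Lc l) (smStep d Lc l) (T2RecAt d Lc (toSite r) cE cVH cΛ cE₂ cB Tc vh₂S (mixFFAt (toSite r) Lc) l)) κ u κ' u')))) κ u κ' u' x p a (Sum.inl β)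
        - (((1 : ℝ) / 2) • (unitS₂ (sfStep Lc l) (smStep d Lc l) (T2RecAt d Lc (toSite r) cE cVH cΛ cE₂ cB Tc vh₂S (mixFFAt (toSite r) Lc) l) + ε • fun κ u κ' u' => sgnK (trK ((unitS₂ (sfStep Lc l) (smStep d Lc l) (T2RecAt d Lc (toSite r) cE cVH cΛ cE₂ cB Tc vh₂S (mixFFAt (toSite r) Lc) l)) κ u κ' u')))) κ u κ' u' x (p - unitVec β) a (Sum.inl β))) (M + (Cg * σ + s) * (1 - θ)⁻¹) δ) := by
  have h := fun l => legRows_of_rdiv_half (unitS₂ (sfStep Lc l) (smStep d Lc l) (T2RecAt d Lc (toSite r) cE cVH cΛ cE₂ cB Tc vh₂S (mixFFAt (toSite r) Lc) l)) hε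
    (locStencil₂_rdiv_halfMember_of_chain_rows_bdd hLc hr cE cVH cΛ cE₂ cB Tc hBff hBmm hB ((1 : ℝ) / 2) ε δ hk hθ0 hθ1 hCg hs hM hσ H1 H2 H0 H3 l)
  exact ⟨fun l => (h l).1, fun l => (h l).2⟩

end Summit.QuantumFields.BalabanUV.Beta.GAN24.LegLetterRowsOfLegChain

namespace Summit.QuantumFields.BalabanUV.Beta.GAN24.LegLetterRowsOfLegChain

section Three

variable {Lc : ℕ} [NeZero Lc] {r : Fin (3 + 1) → ℕ}

/-- NOT IN PRINT; OUR BOOKKEEPING.  **`d = 3`: THE TWO LEG LETTER ROWS OF FILE 3c ∕ PART C FROM THE RULED CHAIN ROWS** (`legRows_halfMember_of_chain_rows` at `d := 3`; the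
consumer sets `ε := 1` for the EVEN member and reads `hL₁ hL₂` with `CL₁ = CL₂ := M + (Cg·σ + s)·(1 − θ)⁻¹`).  DISPLAYED: (H1♮)_δ, (H2)_δ, (H0)_δ, (H3) — NOTHING of (Q-L)
is discharged unconditionally. -/
theorem legRows_halfMember_three_of_chain_rows (hLc : 1 ≤ Lc) (hr : r ∈ box (3 + 1) Lc) (cE cVH cΛ cE₂ cB : ℝ)
    (Tc : Fin 4 → Fin 4 → Fin 4 → Fin 4 → ℝ) {vh₂S : (Fin (3 + 1) → (Fin (3 + 1) → ℤ) → Fin (3 + 1) → (Fin (3 + 1) → ℤ) → MKer (3 + 1) (Fib 3))}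
    (hBff : ∀ κ u κ' u' x z (α β : Fin (3 + 1)), vh₂S κ u κ' u' x z (Sum.inl α) (Sum.inl β) = 0)
    (hBmm : ∀ κ u κ' u' x z (μ ν : Fin (3 + 1)), vh₂S κ u κ' u' x z (Sum.inr μ) (Sum.inr ν) = 0)
    (hB : ∃ C δ : ℝ, 0 < δ ∧ LocStencil₂ vh₂S C δ) {ε : ℝ} (hε : ε * ε = 1)
    {GoodL : (Fin (3 + 1) → (Fin (3 + 1) → ℤ) → Fin (3 + 1) → (Fin (3 + 1) → ℤ) → MKer (3 + 1) (Fib 3)) → ℝ → Prop} (δ : ℝ)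
    {k₀ : ℕ} (hk : 0 < k₀) {θ Cg s M σ : ℝ} (hθ0 : 0 ≤ θ) (hθ1 : θ < 1) (hCg : 0 ≤ Cg) (hs : 0 ≤ s) (hM : 0 ≤ M) (hσ : 0 ≤ σ)
    (H1 : ∀ n (W : (Fin (3 + 1) → (Fin (3 + 1) → ℤ) → Fin (3 + 1) → (Fin (3 + 1) → ℤ) → MKer (3 + 1) (Fib 3))) (C g : ℝ), (∃ B : ℝ, ∀ κ u κ' u' x z a b, |W κ u κ' u' x z a b| ≤ B) → LocStencil₂ W C δ → GoodL W g →
        LocStencil₂ (legChain (fun _ : ℕ => -((cE₂ * (Lc : ℝ) ^ (2 * (3 + 1))) * ((Lc : ℝ) ^ (3 + 1))⁻¹))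
          (fun m => unitK (sfStep Lc m) (smStep 3 Lc m) (coDressKBmAt (toSite r) Lc (KInvStep (d := 3) Lc m))) Lc n k₀
          (fun κ u κ' u' => bsumPow Lc k₀ (W κ u κ' u'))) (θ * C + Cg * g) δ)
    (H2 : ∀ n, LocStencil₂ (∑ m ∈ Finset.range k₀, transport (legStepB (fun _ : ℕ => -((cE₂ * (Lc : ℝ) ^ (2 * (3 + 1))) * ((Lc : ℝ) ^ (3 + 1))⁻¹))
      (fun m => unitK (sfStep Lc m) (smStep 3 Lc m) (coDressKBmAt (toSite r) Lc (KInvStep (d := 3) Lc m))) Lc) (n + m + 1) (k₀ - 1 - m)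
      (fun κ u κ' u' => rdiv ((((1 : ℝ) / 2) • ((fun κ u κ' u' => (cE₂ * (Lc : ℝ) ^ (2 * (3 + 1))) • mmRead Lc (K3OfK (unitK (sfStep Lc (n + m)) (smStep 3 Lc (n + m)) (coDressKBmAt (toSite r) Lc (KInvStep (d := 3) Lc (n + m)))) Lc (unitS (sfStep Lc (n + m)) (smStep 3 Lc (n + m)) (SpureRecAt 3 Lc (toSite r) cE cVH cΛ (n + m))) (unitM (sfStep Lc (n + m)) (smStep 3 Lc (n + m)) (M1At 3 Lc (toSite r) cΛ (n + m))) (W2SymOfK (unitK (sfStep Lc (n + m)) (smStep 3 Lc (n + m)) (coDressKBmAt (toSite r) Lc (KInvStep (d := 3) Lc (n + m)))) Lc (unitS (sfStep Lc (n + m)) (smStep 3 Lc (n + m)) (SpureRecAt 3 Lc (toSite r) cE cVH cΛ (n + m))) (unitM (sfStep Lc (n + m)) (smStep 3 Lc (n + m)) (M1At 3 Lc (toSite r) cΛ (n + m))) 0 (unitM₂ (sfStep Lc (n + m)) (smStep 3 Lc (n + m)) (M2Of 3 Lc (mixFFAt (toSite r) Lc) (n + m)))) κ u κ' u') + cB •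 vh₂S κ u κ' u') + ε • fun κ u κ' u' => sgnK (trK ((fun κ u κ' u' => (cE₂ * (Lc : ℝ) ^ (2 * (3 + 1))) • mmRead Lc (K3OfK (unitK (sfStep Lc (n + m)) (smStep 3 Lc (n + m)) (coDressKBmAt (toSite r) Lc (KInvStep (d := 3) Lc (n + m)))) Lc (unitS (sfStep Lc (n + m)) (smStep 3 Lc (n + m)) (SpureRecAt 3 Lc (toSite r) cE cVH cΛ (n + m))) (unitM (sfStep Lc (n + m)) (smStep 3 Lc (n + m)) (M1At 3 Lc (toSite r) cΛ (n + m))) (W2SymOfK (unitK (sfStep Lc (n + m)) (smStep 3 Lc (n + m)) (coDressKBmAt (toSite r) Lc (KInvStep (d := 3) Lc (n + m)))) Lc (unitS (sfStep Lc (n + m)) (smStep 3 Lc (n + m)) (SpureRecAt 3 Lc (toSite r) cE cVH cΛ (n + m))) (unitM (sfStep Lc (n + m)) (smStep 3 Lc (n + m)) (M1At 3 Lc (toSite r) cΛ (n + m))) 0 (unitM₂ (sfStep Lc (n + m)) (smStep 3 Lc (n + m)) (M2Of 3 Lc (mixFFAt (toSite r) Lc) (n + m)))) κ u κ' u') + cB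 • vh₂S κ u κ' u') κ u κ' u')))) κ u κ' u'))) s δ)
    (H0 : ∀ i, i < k₀ → LocStencil₂ (fun κ u κ' u' => rdiv ((((1 : ℝ) / 2) • (unitS₂ (sfStep Lc i) (smStep 3 Lc i) (T2RecAt 3 Lc (toSite r) cE cVH cΛ cE₂ cB Tc vh₂S (mixFFAt (toSite r) Lc) i) + ε • fun κ u κ' u' => sgnK (trK ((unitS₂ (sfStep Lc i) (smStep 3 Lc i) (T2RecAt 3 Lc (toSite r) cE cVH cΛ cE₂ cB Tc vh₂S (mixFFAt (toSite r) Lc) i)) κ u κ' u')))) κ u κ' u')) M δ)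
    (H3 : ∀ n, GoodL (fun κ u κ' u' => rdiv ((((1 : ℝ) / 2) • (unitS₂ (sfStep Lc n) (smStep 3 Lc n) (T2RecAt 3 Lc (toSite r) cE cVH cΛ cE₂ cB Tc vh₂S (mixFFAt (toSite r) Lc) n) + ε • fun κ u κ' u' => sgnK (trK ((unitS₂ (sfStep Lc n) (smStep 3 Lc n) (T2RecAt 3 Lc (toSite r) cE cVH cΛ cE₂ cB Tc vh₂S (mixFFAt (toSite r) Lc) n)) κ u κ' u')))) κ u κ' u')) σ) :
    (∀ l, LocStencil₂ (fun κ u κ' u' => fun (p z : Fin (3 + 1) → ℤ) (_ : Fib 3) (b : Fib 3) =>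
      ∑ β : Fin (3 + 1), ((((1 : ℝ) / 2) • (unitS₂ (sfStep Lc l) (smStep 3 Lc l) (T2RecAt 3 Lc (toSite r) cE cVH cΛ cE₂ cB Tc vh₂S (mixFFAt (toSite r) Lc) l) + ε • fun κ u κ' u' => sgnK (trK ((unitS₂ (sfStep Lc l) (smStep 3 Lc l) (T2RecAt 3 Lc (toSite r) cE cVH cΛ cE₂ cB Tc vh₂S (mixFFAt (toSite r) Lc) l)) κ u κ' u')))) κ u κ' u' p z (Sum.inl β) b
        - (((1 : ℝ) / 2) • (unitS₂ (sfStep Lc l) (smStep 3 Lc l) (T2RecAt 3 Lc (toSite r) cE cVH cΛ cE₂ cB Tc vh₂S (mixFFAt (toSite r) Lc) l) + ε • fun κ u κ' u' => sgnK (trK ((unitS₂ (sfStep Lc l) (smStep 3 Lc l) (T2RecAt 3 Lc (toSite r) cE cVH cΛ cE₂ cB Tc vh₂S (mixFFAt (toSite r) Lc) l)) κ u κ' u')))) κ u κ' u' (p - unitVec β) z (Sum.inl β) b)) (M + (Cg * σ + s) * (1 - θ)⁻¹) δ) ∧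
    (∀ l, LocStencil₂ (fun κ u κ' u' => fun (x p : Fin (3 + 1) → ℤ) (a : Fib 3) (_ : Fib 3) =>
      ∑ β : Fin (3 + 1), ((((1 : ℝ) / 2) • (unitS₂ (sfStep Lc l) (smStep 3 Lc l) (T2RecAt 3 Lc (toSite r) cE cVH cΛ cE₂ cB Tc vh₂S (mixFFAt (toSite r) Lc) l) + ε • fun κ u κ' u' => sgnK (trK ((unitS₂ (sfStep Lc l) (smStep 3 Lc l) (T2RecAt 3 Lc (toSite r) cE cVH cΛ cE₂ cB Tc vh₂S (mixFFAt (toSite r) Lc) l)) κ u κ' u')))) κ u κ' u' x p a (Sum.inl β)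
        - (((1 : ℝ) / 2) • (unitS₂ (sfStep Lc l) (smStep 3 Lc l) (T2RecAt 3 Lc (toSite r) cE cVH cΛ cE₂ cB Tc vh₂S (mixFFAt (toSite r) Lc) l) + ε • fun κ u κ' u' => sgnK (trK ((unitS₂ (sfStep Lc l) (smStep 3 Lc l) (T2RecAt 3 Lc (toSite r) cE cVH cΛ cE₂ cB Tc vh₂S (mixFFAt (toSite r) Lc) l)) κ u κ' u')))) κ u κ' u' x (p - unitVec β) a (Sum.inl β))) (M + (Cg * σ + s) * (1 - θ)⁻¹) δ) :=
  legRows_halfMember_of_chain_rows (d := 3) hLc hr cE cVH cΛ cE₂ cB Tc hBff hBmm hB hε δ hk hθ0 hθ1 hCg hs hM hσ H1 H2 H0 H3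

end Three

end Summit.QuantumFields.BalabanUV.Beta.GAN24.LegLetterRowsOfLegChain
end
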